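import Literature.MathematicalPhysics.QuantumFieldTheory.Balaban1983to89.B4Eq19LatticeOperators

/-!
# `Balaban1983to89.B4Eq19LatticeMixedSobolev` — T. Bałaban, *Propagators and renormalization transformations for lattice gauge theories. II*,
# Commun. Math. Phys. **96** (1984) 223–250 [Balaban1984PropagatorsII] (1.9) p. 226: **MIXED FORWARD DIFFERENCES `∂_S` AND THE MIXED-DIFFERENCE SOBOLEV
# EMBEDDING ON CUBES OF `ℤ^d`** — `|F(x)| ≤ Σ_{S ⊆ T} (ℓ+1)^{|S|−|T|} Σ_{v ∈ [0,ℓ]^T} |∂_S F(x + v)|` and its squared form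
# `F(x)² ≤ 2^{|T|} Σ_{S ⊆ T} (ℓ+1)^{2|S|−|T|} Σ_{v ∈ [0,ℓ]^T} (∂_S F(x+v))²` — the elementary `L² → L^∞` device (iterated one-dimensional telescoping) that,
# with the iterated Caccioppoli inequality, gives the sup bound for `κ`-harmonic functions in the Campanato road ([Giaquinta1984] Ch. III §2) to the LOCAL
# η-scale Hölder estimate `Hloc` of `B9Eq343FlatWindowLetterOfLocalHolder`.

statement-level skeleton of published theorems with citation tags; proofs where landed; nothing here is a claim about the Yang–Mills mass gap

CITATION HEADER (lean-in-tree rule).  Audit cell `pub-balaban`, sub-cell `t4`, BINDER row NE9; filed by NE9 crux-team LEAF PROVER 01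
(`b2b-balaban-t4-ne9-formalise-leaf-01`, gen 94; bears_on: R4/N22).  CONTENT: [folklore] lattice calculus (mixed differences by inclusion–exclusion; the
discrete analogue of the embedding `W^{d,1}_{mixed} ⊂ L^∞` by iterated one-dimensional averaging + telescoping).  Nothing of [Balaban1984PropagatorsII]
is asserted.

WHAT IS DEFINED (reviewed, elementary): `fdS S F y = Σ_{T ⊆ S} (−1)^{|S|−|T|} F(y + Σ_{i∈T} e_i)` (the mixed forward difference `∂_S = Π_{i∈S} ∂_i`);
`cube T ℓ` (the offsets `v ∈ ℤ^d` with `0 ≤ v_i ≤ ℓ` for `i ∈ T`, `v_i = 0` otherwise).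
WHAT IS PROVED (sorry-free): `fdS_empty`, `fdS_insert` (`∂_{S∪{j}} = ∂_j ∂_S`), `lop_fdS_eq_zero_of_harmonic` (`∂_S` of a `κ`-harmonic function on
`Q_{r+|S|}(z)` is `κ`-harmonic on `Q_r(z)`); `mem_cube`, `cube_empty`, `card_cube`, `sum_cube_insert` (one-coordinate splitting), `add_mem_box_of_mem_cube`;
`abs_le_lineAvg_add_lineVar` (the one-dimensional step); **`abs_le_sum_powerset_cube`** (the `ℓ¹` embedding); **`sq_le_sum_powerset_cube`** (the squared form).
HONEST SCOPE.  Definitions + [folklore] lattice calculus; no estimate of the papers; NOT summit progress (cell pub-balaban: NE9 NOT PRINTED ∕ NOT PROVED;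
spine PROVED 0∕9; finite T⁴ — NOT infinite volume, NOT mass gap, NOT BetaPertH, NOT Clay).  NEW file importing `B4Eq19LatticeOperators` only.
Net new unproved facts: 0.
-/

noncomputable section

open scoped BigOperators
open Finset

namespace Literature.MathematicalPhysics.QuantumFieldTheory.Balaban1983to89.B4Eq19LatticeMixedSobolev

open B4Eq19LatticeOperators

variable {d : ℕ}

/-! ## §1 Mixed forward differences -/

/-- **The mixed forward difference** `∂_S F(y) = Σ_{T ⊆ S} (−1)^{|S|−|T|} F(y + Σ_{i∈T} e_i)` (`= Π_{i ∈ S} ∂_i F`, the `∂_i` commute).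
[folklore] [cite: Giaquinta1984, Ch. III §2 p.78] -/
def fdS (S : Finset (Fin d)) (F : Zd d → ℝ) (y : Zd d) : ℝ :=
  ∑ T ∈ S.powerset, (-1 : ℝ) ^ (S.card - T.card) * F (y + ∑ i ∈ T, unitVec i)

/-- `∂_∅ F = F`. [folklore] [cite: Giaquinta1984, Ch. III §2 p.78] -/
theorem fdS_empty (F : Zd d → ℝ) (y : Zd d) : fdS ∅ F y = F y := by
  simp [fdS]

/-- **`∂_{S ∪ {j}} = ∂_j ∂_S`** for `j ∉ S`. [folklore] [cite: Giaquinta1984, Ch. III §2 p.78] -/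
theorem fdS_insert {S : Finset (Fin d)} {j : Fin d} (hj : j ∉ S) (F : Zd d → ℝ) (y : Zd d) :
    fdS (insert j S) F y = fdiff j (fdS S F) y := by
  classical
  rw [fdS, Finset.sum_powerset_insert hj, fdiff, fdS, fdS]
  have h1 : ∀ T ∈ S.powerset, (-1 : ℝ) ^ ((insert j S).card - T.card) * F (y + ∑ i ∈ T, unitVec i) =
      -((-1 : ℝ) ^ (S.card - T.card) * F (y + ∑ i ∈ T, unitVec i)) := by
    intro T hT
    have hTS : T ⊆ S := Finset.mem_powerset.1 hT
    have hcard : T.card ≤ S.card := Finset.card_le_card hTS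
    rw [Finset.card_insert_of_notMem hj, show S.card + 1 - T.card = (S.card - T.card) + 1 by omega, pow_succ]
    ring
  have h2 : ∀ T ∈ S.powerset, (-1 : ℝ) ^ ((insert j S).card - (insert j T).card) * F (y + ∑ i ∈ insert j T, unitVec i) =
      (-1 : ℝ) ^ (S.card - T.card) * F (y + unitVec j + ∑ i ∈ T, unitVec i) := by
    intro T hT
    have hTS : T ⊆ S := Finset.mem_powerset.1 hT
    have hjT : j ∉ T := fun h => hj (hTS h)
    rw [Finset.card_insert_of_notMem hj, Finset.card_insert_of_notMem hjT, Finset.sum_insert hjT,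
      show S.card + 1 - (T.card + 1) = S.card - T.card by omega, ← add_assoc]
  rw [Finset.sum_congr rfl h1, Finset.sum_congr rfl h2, Finset.sum_neg_distrib]
  ring

/-- `∂_S` is linear: differences. [folklore] [cite: Giaquinta1984, Ch. III §2 p.78] -/
theorem fdS_sub (S : Finset (Fin d)) (F G : Zd d → ℝ) (y : Zd d) :
    fdS S (fun x => F x - G x) y = fdS S F y - fdS S G y := by
  simp only [fdS, mul_sub, Finset.sum_sub_distrib]

/-- **`∂_S` of a `κ`-harmonic function is `κ`-harmonic on the shrunk box**: if `(−Δ+κ)F = 0` on `Q_{r + |S|}(z)` then `(−Δ+κ)(∂_S F) = 0` on `Q_r(z)`.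
[folklore] [cite: Giaquinta1984, Ch. III §2 p.78] -/
theorem lop_fdS_eq_zero_of_harmonic {κ : ℝ} {z : Zd d} (S : Finset (Fin d)) :
    ∀ (F : Zd d → ℝ) (r : ℤ), (∀ y ∈ box z (r + S.card), lop κ F y = 0) → ∀ y ∈ box z r, lop κ (fdS S F) y = 0 := by
  classical
  induction S using Finset.induction_on with
  | empty =>
    intro F r hF y hy
    have : lop κ (fdS ∅ F) y = lop κ F y := by
      simp only [lop, fdS_empty]
    rw [this]
    exact hF y (by simpa using hy)
  | insert j S hj ih =>
    intro F r hF y hy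
    have e : ∀ x, fdS (insert j S) F x = fdiff j (fdS S F) x := fun x => fdS_insert hj F x
    have : lop κ (fdS (insert j S) F) y = lop κ (fdiff j (fdS S F)) y := by
      simp only [lop, e]
    rw [this]
    have hS : ∀ x ∈ box z (r + 1), lop κ (fdS S F) x = 0 := by
      refine ih F (r + 1) (fun x hx => hF x ?_)
      rw [Finset.card_insert_of_notMem hj]; push_cast
      rwa [show r + ((S.card : ℤ) + 1) = r + 1 + S.card by ring]
    exact lop_fdiff_eq_zero hS j (box_mono z (by linarith) hy) (add_unitVec_mem_box hy j)

/-! ## §2 Cubes of offsets -/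

/-- **The cube of offsets in the directions `T`**: `{v ∈ ℤ^d : 0 ≤ v_i ≤ ℓ (i ∈ T), v_i = 0 (i ∉ T)}`. [folklore] [cite: Giaquinta1984, Ch. III §1 p.64] -/
def cube (T : Finset (Fin d)) (ℓ : ℕ) : Finset (Zd d) :=
  Fintype.piFinset fun i => if i ∈ T then Finset.Icc (0 : ℤ) ℓ else {0}

/-- Membership in a cube. [folklore] [cite: Giaquinta1984, Ch. III §1 p.64] -/
theorem mem_cube {T : Finset (Fin d)} {ℓ : ℕ} {v : Zd d} :
    v ∈ cube T ℓ ↔ ∀ i, (i ∈ T → 0 ≤ v i ∧ v i ≤ ℓ) ∧ (i ∉ T → v i = 0) := by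
  simp only [cube, Fintype.mem_piFinset]
  refine forall_congr' fun i => ?_
  by_cases hi : i ∈ T
  · simp [hi]
  · simp [hi]

/-- The cube with no directions is `{0}`. [folklore] [cite: Giaquinta1984, Ch. III §1 p.64] -/
theorem cube_empty (ℓ : ℕ) : cube (∅ : Finset (Fin d)) ℓ = {0} := by
  ext v
  rw [mem_cube, Finset.mem_singleton]
  constructor
  · intro h; funext i; exact (h i).2 (by simp)
  · intro h i; subst h; simp

/-- **Cardinality of a cube**: `#cube T ℓ = (ℓ+1)^{|T|}`. [folklore] [cite: Giaquinta1984, Ch. III §1 p.64] -/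
theorem card_cube (T : Finset (Fin d)) (ℓ : ℕ) : (cube T ℓ).card = (ℓ + 1) ^ T.card := by
  classical
  rw [cube, Fintype.card_piFinset]
  have h : ∀ i : Fin d, (if i ∈ T then Finset.Icc (0 : ℤ) ℓ else {0} : Finset ℤ).card = if i ∈ T then ℓ + 1 else 1 := by
    intro i
    by_cases hi : i ∈ T
    · rw [if_pos hi, if_pos hi, Int.card_Icc]; simp
    · rw [if_neg hi, if_neg hi, Finset.card_singleton]
  simp only [h]
  rw [Finset.prod_ite, Finset.prod_const, Finset.prod_const_one, mul_one]
  congr 1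
  simp

/-- Offsets in a cube have coordinates in `[0, ℓ]`. [folklore] [cite: Giaquinta1984, Ch. III §1 p.64] -/
theorem abs_le_of_mem_cube {T : Finset (Fin d)} {ℓ : ℕ} {v : Zd d} (hv : v ∈ cube T ℓ) (i : Fin d) : 0 ≤ v i ∧ v i ≤ ℓ := by
  rw [mem_cube] at hv
  by_cases hi : i ∈ T
  · exact (hv i).1 hi
  · have := (hv i).2 hi; rw [this]; exact ⟨le_rfl, by positivity⟩

/-- A cube offset keeps a point of `Q_ρ(z)` inside `Q_{ρ+ℓ}(z)`. [folklore] [cite: Giaquinta1984, Ch. III §1 p.64] -/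
theorem add_mem_box_of_mem_cube {T : Finset (Fin d)} {ℓ : ℕ} {v : Zd d} (hv : v ∈ cube T ℓ) {z x : Zd d} {ρ : ℤ}
    (hx : x ∈ box z ρ) : x + v ∈ box z (ρ + ℓ) := by
  rw [mem_box] at hx ⊢
  intro i
  obtain ⟨h0, h1⟩ := abs_le_of_mem_cube hv i
  have := hx i
  simp only [Pi.add_apply]
  rw [abs_le] at this ⊢
  constructor <;> linarith

/-- **One-coordinate splitting of a cube sum**: for `j ∉ T`,
`Σ_{v ∈ cube (T ∪ {j}) ℓ} Ψ(v) = Σ_{t=0}^{ℓ} Σ_{v ∈ cube T ℓ} Ψ(v + t·e_j)`. [folklore] [cite: Giaquinta1984, Ch. III §1 p.64] -/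
theorem sum_cube_insert {α : Type*} [AddCommMonoid α] {T : Finset (Fin d)} {j : Fin d} (hj : j ∉ T) (ℓ : ℕ) (Ψ : Zd d → α) :
    ∑ v ∈ cube (insert j T) ℓ, Ψ v = ∑ t ∈ Finset.Icc (0 : ℤ) ℓ, ∑ v ∈ cube T ℓ, Ψ (v + t • unitVec j) := by
  classical
  have hδ : Function.update (fun i => if i ∈ insert j T then Finset.Icc (0 : ℤ) ℓ else ({0} : Finset ℤ)) j {0} =
      fun i => if i ∈ T then Finset.Icc (0 : ℤ) ℓ else {0} := by
    funext i
    by_cases hi : i = j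
    · subst hi; simp [hj]
    · rw [Function.update_of_ne hi]; simp [hi]
  rw [cube, sum_piFinset_eq_sum_update _ j 0 Ψ, if_pos (Finset.mem_insert_self j T), hδ]
  refine Finset.sum_congr rfl fun t _ => Finset.sum_congr rfl fun v hv => ?_
  congr 1
  funext i
  by_cases hi : i = j
  · subst hi
    have hv0 : v i = 0 := ((mem_cube.1 hv) i).2 hj
    simp [hv0]
  · rw [Function.update_of_ne hi]; simp [Pi.add_apply, unitVec_apply_ne hi]

/-! ## §3 The one-dimensional step: value ≤ line average + line variation -/

/-- Telescoping along a lattice line: `G(x + t·e_j) − G(x) = Σ_{s<t} ∂_jG(x + s·e_j)`. [folklore] [cite: Giaquinta1984, Ch. III §1 p.65] -/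
theorem sub_eq_sum_fdiff (G : Zd d → ℝ) (x : Zd d) (j : Fin d) (t : ℕ) :
    G (x + (t : ℤ) • unitVec j) - G x = ∑ s ∈ Finset.range t, fdiff j G (x + (s : ℤ) • unitVec j) := by
  induction t with
  | zero => simp
  | succ t ih =>
    rw [Finset.sum_range_succ, ← ih, fdiff, Nat.cast_succ, add_smul, one_smul, ← add_assoc]
    ring

/-- A sum over `Icc (0:ℤ) ℓ` is the sum over `range (ℓ+1)` through the cast. [folklore] [cite: Giaquinta1984, Ch. III §1 p.65] -/
theorem sum_Icc_int_eq_sum_range {α : Type*} [AddCommMonoid α] (ℓ : ℕ) (f : ℤ → α) :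
    ∑ t ∈ Finset.Icc (0 : ℤ) ℓ, f t = ∑ t ∈ Finset.range (ℓ + 1), f (t : ℤ) := by
  refine Finset.sum_nbij' (fun t : ℤ => t.toNat) (fun n : ℕ => (n : ℤ)) ?_ ?_ ?_ ?_ ?_
  · intro t ht; rw [Finset.mem_Icc] at ht; rw [Finset.mem_range]; omega
  · intro n hn; rw [Finset.mem_range] at hn; rw [Finset.mem_Icc]; omega
  · intro t ht; rw [Finset.mem_Icc] at ht; simp; omega
  · intro n _; simp
  · intro t ht; rw [Finset.mem_Icc] at ht; congr 1; omega

/-- **THE ONE-DIMENSIONAL STEP**: `|G(x)| ≤ (ℓ+1)⁻¹ Σ_{t=0}^{ℓ} |G(x + t·e_j)| + Σ_{t=0}^{ℓ} |∂_jG(x + t·e_j)|` (average the telescoping identity over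
`t ∈ [0, ℓ]`). [folklore] [cite: Giaquinta1984, Ch. III §1 p.65] -/
theorem abs_le_lineAvg_add_lineVar (G : Zd d → ℝ) (x : Zd d) (j : Fin d) (ℓ : ℕ) :
    |G x| ≤ ((ℓ : ℝ) + 1)⁻¹ * ∑ t ∈ Finset.Icc (0 : ℤ) ℓ, |G (x + t • unitVec j)| +
      ∑ t ∈ Finset.Icc (0 : ℤ) ℓ, |fdiff j G (x + t • unitVec j)| := by
  rw [sum_Icc_int_eq_sum_range, sum_Icc_int_eq_sum_range]
  set V := ∑ t ∈ Finset.range (ℓ + 1), |fdiff j G (x + (t : ℤ) • unitVec j)| with hV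
  have hV0 : 0 ≤ V := Finset.sum_nonneg fun _ _ => abs_nonneg _
  have hpt : ∀ t ∈ Finset.range (ℓ + 1), |G x| ≤ |G (x + (t : ℤ) • unitVec j)| + V := by
    intro t ht
    rw [Finset.mem_range] at ht
    have h := sub_eq_sum_fdiff G x j t
    have h2 : |∑ s ∈ Finset.range t, fdiff j G (x + (s : ℤ) • unitVec j)| ≤ V :=
      (Finset.abs_sum_le_sum_abs _ _).trans (Finset.sum_le_sum_of_subset_of_nonneg
        (Finset.range_subset_range.2 (by omega)) fun _ _ _ => abs_nonneg _)
    have h3 : |G x - G (x + (t : ℤ) • unitVec j)| ≤ V := by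
      rw [abs_sub_comm, h]; exact h2
    have := abs_sub_abs_le_abs_sub (G x) (G (x + (t : ℤ) • unitVec j))
    linarith
  have hsum : ((ℓ : ℝ) + 1) * |G x| ≤ ∑ t ∈ Finset.range (ℓ + 1), |G (x + (t : ℤ) • unitVec j)| + ((ℓ : ℝ) + 1) * V := by
    have := Finset.sum_le_sum hpt
    simp only [Finset.sum_const, Finset.card_range, nsmul_eq_mul, Finset.sum_add_distrib, Nat.cast_add, Nat.cast_one] at this
    linarith
  have hl : (0 : ℝ) < (ℓ : ℝ) + 1 := by positivity
  rw [← le_div_iff₀' hl] at hsum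
  have e : (∑ t ∈ Finset.range (ℓ + 1), |G (x + (t : ℤ) • unitVec j)| + ((ℓ : ℝ) + 1) * V) / ((ℓ : ℝ) + 1) =
      ((ℓ : ℝ) + 1)⁻¹ * ∑ t ∈ Finset.range (ℓ + 1), |G (x + (t : ℤ) • unitVec j)| + V := by
    field_simp
  rw [e] at hsum
  exact hsum

/-! ## §4 The mixed-difference Sobolev embedding on cubes -/

/-- **THE MIXED-DIFFERENCE SOBOLEV EMBEDDING (`ℓ¹` form)**: for every finite set of directions `T`, every `F : ℤ^d → ℝ`, `x ∈ ℤ^d`, `ℓ ∈ ℕ`,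
`|F(x)| ≤ Σ_{S ⊆ T} (ℓ+1)^{−(|T|−|S|)} Σ_{v ∈ cube T ℓ} |∂_S F(x + v)|` (induction on `T` by the one-dimensional step applied to `∂_S F`).
[folklore] [cite: Giaquinta1984, Ch. III §1 Thm 1.2 p.70] -/
theorem abs_le_sum_powerset_cube (T : Finset (Fin d)) :
    ∀ (F : Zd d → ℝ) (x : Zd d) (ℓ : ℕ),
      |F x| ≤ ∑ S ∈ T.powerset, (((ℓ : ℝ) + 1)⁻¹) ^ (T.card - S.card) * ∑ v ∈ cube T ℓ, |fdS S F (x + v)| := by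
  classical
  induction T using Finset.induction_on with
  | empty =>
    intro F x ℓ
    simp [cube_empty, fdS_empty]
  | insert j T hj ih =>
    intro F x ℓ
    set q : ℝ := ((ℓ : ℝ) + 1)⁻¹ with hq
    have hq0 : 0 ≤ q := by positivity
    -- the induction hypothesis at the points of the line through `x` in direction `j`, for `F` and for `∂_j F`
    have step1 := abs_le_lineAvg_add_lineVar F x j ℓ
    have hA : ∀ t : ℤ, |F (x + t • unitVec j)| ≤
        ∑ S ∈ T.powerset, q ^ (T.card - S.card) * ∑ v ∈ cube T ℓ, |fdS S F (x + t • unitVec j + v)| := fun t => ih F _ ℓ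
    have hB : ∀ t : ℤ, |fdiff j F (x + t • unitVec j)| ≤
        ∑ S ∈ T.powerset, q ^ (T.card - S.card) * ∑ v ∈ cube T ℓ, |fdS S (fdiff j F) (x + t • unitVec j + v)| := fun t => ih (fdiff j F) _ ℓ
    -- `∂_S ∂_j F = ∂_{S ∪ {j}} F` for `S ⊆ T` (so `j ∉ S`)
    have hSj : ∀ S ∈ T.powerset, ∀ y, fdS S (fdiff j F) y = fdS (insert j S) F y := by
      intro S hS y
      have hjS : j ∉ S := fun h => hj (Finset.mem_powerset.1 hS h)
      rw [fdS_insert hjS]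
      -- `∂_j ∂_S = ∂_S ∂_j`: both are `Σ_T (−1)^{..} (F(y + e_j + Σ_T) − F(y + Σ_T))`
      simp only [fdS, fdiff, mul_sub, Finset.sum_sub_distrib, add_right_comm _ (unitVec j)]
    calc |F x| ≤ q * ∑ t ∈ Finset.Icc (0 : ℤ) ℓ, |F (x + t • unitVec j)| + ∑ t ∈ Finset.Icc (0 : ℤ) ℓ, |fdiff j F (x + t • unitVec j)| := step1
      _ ≤ q * ∑ t ∈ Finset.Icc (0 : ℤ) ℓ, ∑ S ∈ T.powerset, q ^ (T.card - S.card) * ∑ v ∈ cube T ℓ, |fdS S F (x + t • unitVec j + v)| +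
          ∑ t ∈ Finset.Icc (0 : ℤ) ℓ, ∑ S ∈ T.powerset, q ^ (T.card - S.card) * ∑ v ∈ cube T ℓ, |fdS (insert j S) F (x + t • unitVec j + v)| := by
          gcongr with t _ t ht
          · exact hA t
          · refine (hB t).trans (le_of_eq (Finset.sum_congr rfl fun S hS => ?_))
            rw [Finset.sum_congr rfl fun v _ => by rw [hSj S hS]]
      _ = ∑ S ∈ T.powerset, q ^ ((insert j T).card - S.card) * ∑ v ∈ cube (insert j T) ℓ, |fdS S F (x + v)| +
          ∑ S ∈ T.powerset, q ^ ((insert j T).card - (insert j S).card) * ∑ v ∈ cube (insert j T) ℓ, |fdS (insert j S) F (x + v)| := by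
          congr 1
          · have e1 : q * ∑ t ∈ Finset.Icc (0 : ℤ) ℓ, ∑ S ∈ T.powerset, q ^ (T.card - S.card) * ∑ v ∈ cube T ℓ, |fdS S F (x + t • unitVec j + v)| =
                ∑ t ∈ Finset.Icc (0 : ℤ) ℓ, ∑ S ∈ T.powerset, q ^ (T.card - S.card + 1) * ∑ v ∈ cube T ℓ, |fdS S F (x + t • unitVec j + v)| := by
              rw [Finset.mul_sum]
              refine Finset.sum_congr rfl fun t _ => ?_
              rw [Finset.mul_sum]
              refine Finset.sum_congr rfl fun S _ => ?_
              rw [pow_succ]; ring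
            rw [e1, Finset.sum_comm]
            refine Finset.sum_congr rfl fun S hS => ?_
            have hcard : S.card ≤ T.card := Finset.card_le_card (Finset.mem_powerset.1 hS)
            rw [sum_cube_insert hj, Finset.card_insert_of_notMem hj, show T.card + 1 - S.card = T.card - S.card + 1 by omega, Finset.mul_sum]
            refine Finset.sum_congr rfl fun t _ => ?_
            congr 1
            refine Finset.sum_congr rfl fun v _ => ?_
            rw [add_assoc, add_comm (t • unitVec j) v, ← add_assoc]
          · rw [Finset.sum_comm]
            refine Finset.sum_congr rfl fun S hS => ?_
            have hjS : j ∉ S := fun h => hj (Finset.mem_powerset.1 hS h)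
            rw [sum_cube_insert hj, Finset.card_insert_of_notMem hj, Finset.card_insert_of_notMem hjS,
              show T.card + 1 - (S.card + 1) = T.card - S.card by omega, Finset.mul_sum]
            refine Finset.sum_congr rfl fun t _ => ?_
            congr 1
            refine Finset.sum_congr rfl fun v _ => ?_
            rw [add_assoc, add_comm (t • unitVec j) v, ← add_assoc]
      _ = ∑ S ∈ (insert j T).powerset, q ^ ((insert j T).card - S.card) * ∑ v ∈ cube (insert j T) ℓ, |fdS S F (x + v)| := by
          rw [Finset.sum_powerset_insert hj]

/-- **THE MIXED-DIFFERENCE SOBOLEV EMBEDDING (squared form)**: `F(x)² ≤ 2^{|T|} Σ_{S ⊆ T} ((ℓ+1)^{2|S|} ∕ (ℓ+1)^{|T|}) Σ_{v ∈ cube T ℓ} (∂_S F(x+v))²`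
(Cauchy–Schwarz over the `2^{|T|}` subsets and over the `(ℓ+1)^{|T|}` points of the cube). [folklore] [cite: Giaquinta1984, Ch. III §1 Thm 1.2 p.70] -/
theorem sq_le_sum_powerset_cube (T : Finset (Fin d)) (F : Zd d → ℝ) (x : Zd d) (ℓ : ℕ) :
    F x ^ 2 ≤ (2 : ℝ) ^ T.card * ∑ S ∈ T.powerset, (((ℓ : ℝ) + 1) ^ (2 * S.card) / ((ℓ : ℝ) + 1) ^ T.card) *
      ∑ v ∈ cube T ℓ, fdS S F (x + v) ^ 2 := by
  classical
  have hl : (0 : ℝ) < (ℓ : ℝ) + 1 := by positivity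
  have h1 := abs_le_sum_powerset_cube T F x ℓ
  set q : ℝ := ((ℓ : ℝ) + 1)⁻¹ with hq
  -- square and Cauchy–Schwarz over subsets
  have h2 : F x ^ 2 ≤ (∑ S ∈ T.powerset, q ^ (T.card - S.card) * ∑ v ∈ cube T ℓ, |fdS S F (x + v)|) ^ 2 := by
    rw [← sq_abs (F x)]
    exact pow_le_pow_left₀ (abs_nonneg _) h1 2
  have h3 : (∑ S ∈ T.powerset, q ^ (T.card - S.card) * ∑ v ∈ cube T ℓ, |fdS S F (x + v)|) ^ 2 ≤
      (T.powerset.card : ℝ) * ∑ S ∈ T.powerset, (q ^ (T.card - S.card) * ∑ v ∈ cube T ℓ, |fdS S F (x + v)|) ^ 2 :=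
    sq_sum_le_card_mul_sum_sq
  -- Cauchy–Schwarz over the cube
  have h4 : ∀ S ∈ T.powerset, (q ^ (T.card - S.card) * ∑ v ∈ cube T ℓ, |fdS S F (x + v)|) ^ 2 ≤
      (((ℓ : ℝ) + 1) ^ (2 * S.card) / ((ℓ : ℝ) + 1) ^ T.card) * ∑ v ∈ cube T ℓ, fdS S F (x + v) ^ 2 := by
    intro S hS
    have hcard : S.card ≤ T.card := Finset.card_le_card (Finset.mem_powerset.1 hS)
    have hc : ((cube T ℓ).card : ℝ) = ((ℓ : ℝ) + 1) ^ T.card := by rw [card_cube]; push_cast; ring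
    have h5 : (∑ v ∈ cube T ℓ, |fdS S F (x + v)|) ^ 2 ≤ ((cube T ℓ).card : ℝ) * ∑ v ∈ cube T ℓ, |fdS S F (x + v)| ^ 2 :=
      sq_sum_le_card_mul_sum_sq
    simp only [sq_abs] at h5
    rw [hc] at h5
    have hq2 : (q ^ (T.card - S.card)) ^ 2 * ((ℓ : ℝ) + 1) ^ T.card = ((ℓ : ℝ) + 1) ^ (2 * S.card) / ((ℓ : ℝ) + 1) ^ T.card := by
      have hqa : q ^ (T.card - S.card) * ((ℓ : ℝ) + 1) ^ (T.card - S.card) = 1 := by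
        rw [hq, ← mul_pow, inv_mul_cancel₀ (ne_of_gt hl), one_pow]
      have hT : ((ℓ : ℝ) + 1) ^ T.card = ((ℓ : ℝ) + 1) ^ (T.card - S.card) * ((ℓ : ℝ) + 1) ^ S.card := by
        rw [← pow_add]; congr 1; omega
      rw [eq_div_iff (by positivity), hT]
      calc (q ^ (T.card - S.card)) ^ 2 * (((ℓ : ℝ) + 1) ^ (T.card - S.card) * ((ℓ : ℝ) + 1) ^ S.card) *
            (((ℓ : ℝ) + 1) ^ (T.card - S.card) * ((ℓ : ℝ) + 1) ^ S.card)
          = (q ^ (T.card - S.card) * ((ℓ : ℝ) + 1) ^ (T.card - S.card)) ^ 2 * (((ℓ : ℝ) + 1) ^ S.card) ^ 2 := by ring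
        _ = ((ℓ : ℝ) + 1) ^ (2 * S.card) := by rw [hqa, one_pow, one_mul, ← pow_mul, mul_comm]
    calc (q ^ (T.card - S.card) * ∑ v ∈ cube T ℓ, |fdS S F (x + v)|) ^ 2
        = (q ^ (T.card - S.card)) ^ 2 * (∑ v ∈ cube T ℓ, |fdS S F (x + v)|) ^ 2 := by ring
      _ ≤ (q ^ (T.card - S.card)) ^ 2 * (((ℓ : ℝ) + 1) ^ T.card * ∑ v ∈ cube T ℓ, fdS S F (x + v) ^ 2) :=
          mul_le_mul_of_nonneg_left h5 (sq_nonneg _)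
      _ = (((ℓ : ℝ) + 1) ^ (2 * S.card) / ((ℓ : ℝ) + 1) ^ T.card) * ∑ v ∈ cube T ℓ, fdS S F (x + v) ^ 2 := by
          rw [← mul_assoc, hq2]
  have hP : (T.powerset.card : ℝ) = (2 : ℝ) ^ T.card := by rw [Finset.card_powerset]; push_cast; ring
  calc F x ^ 2 ≤ (T.powerset.card : ℝ) * ∑ S ∈ T.powerset, (q ^ (T.card - S.card) * ∑ v ∈ cube T ℓ, |fdS S F (x + v)|) ^ 2 := h2.trans h3
    _ ≤ (2 : ℝ) ^ T.card * ∑ S ∈ T.powerset, (((ℓ : ℝ) + 1) ^ (2 * S.card) / ((ℓ : ℝ) + 1) ^ T.card) * ∑ v ∈ cube T ℓ, fdS S F (x + v) ^ 2 := by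
        rw [hP]
        exact mul_le_mul_of_nonneg_left (Finset.sum_le_sum h4) (by positivity)

end Literature.MathematicalPhysics.QuantumFieldTheory.Balaban1983to89.B4Eq19LatticeMixedSobolev

end
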